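import Summits.QuantumFields.YangMills.Theorems.BalabanUVNodesN21GappedTopPair13CoPHSlotDefs
import Summits.QuantumFields.YangMills.Theorems.BalabanUVNodesN21GappedTopCut13CoPH

/-!
# N21 (NE7c) · THE GAPPED TOP CUT FOR BOTH INDICATOR FAMILIES — term level: «no factor in either collar» (the TWO-FAMILY cover: the pair-lettered term minus
# its doubly-gapped core is at most the (3.2) collar count PLUS the (3.3) collar count times the term, pointwise), the term ∕ the doubly-gapped core ∕ the
# two-collar shell ON THE GRAPH of the averaging of record, and `0 ≤ shell`

WIDTH SEAT `pub-ymgap-dag-n21-w7` (g2), node N21 = NE7c (NOT PRINTED; NOT proved at print's fixed thresholds); lane K3⁷ `SpineGivenEndpointR13SepCoPH`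
(stmt-QuantumFields-20544, `--supports … --as helper`; COUNT-NEUTRAL).  THEOREMS ONLY (0 `def`).  Imports this seat's definition lane `…N21GappedTopPair13CoPHSlotDefs`
∕ `…Defs` (`bFactorAt`, `bGapAt`, `collarBAt`, `wTop2At`, `topSlot2At`, `topClassWeight2At`, `ωGap2At`, `wGap2At`, `topGap2SlotAt∕CoreAt∕ShellAt`) and the lane owner
dag-n21-d's U2 `…N21GappedTopCut13CoPH` (p618614: §29 generic `prod_sub_prod_gap_le_collar_mul` «no factor in the collar», §30 `aWeightAt_sub_aGapAt_le_collar_mul`,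
§31 `integral_mul_tstepOfRecordAt_eq_graph`, `integrable_oldPiece_topLetter`, `integrable_oldPiece_mul_graph`; through it U1 `aGapAt_le_aWeightAt`, `front_absorb_gap`,
T2 `chiSeqOfRecordAt_topLetter_of_lt`, def-T FILE 19 `front_absorb_at`, `isStepUnity_wOfRecordAt`, `abs_wOfRecordAt_le_one`, `measurable_wOfRecordAt_of_localBg`).
The OBJECT half of the (3.3) family accepted from the lane owner (OFFER-2, cell bus 2026-08-28 10:02Z; interface notes (i) «modular cover
`a·b − aGap·bGap = (a − aGap)·b + aGap·(b − bGap) ≤ (collarA + collarB)·(a·b)`» and (ii) «the `(V′, U)`-cofactor `collarB` through def-T's `integral_transport_piece`»).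

WHAT THIS FILE PROVES ([folklore] algebra ∕ the tree's disintegration identity; every row displayed).
* §P1 faces of the pair-lettered step weights BY NAME from def-T: `abs_wTop2At_le_one`, `measurable_wTop2At`, `isStepUnity_wTop2At`.
* §P2 ★ `bWeightAt_sub_bGapAt_le_collarB_mul` (`b|_{δ′} − bGap(δlo,δhi) ≤ collarB(δlo,δhi)·b|_{δ′}` for `δlo ≤ δ′ ≤ δhi`: §29 at the (3.3) factors), ★ `mul_sub_mul_gap_le`
  (the two-family product cover, generic: `0 ≤ Gᵃ ≤ Tᵃ`, `0 ≤ Gᵇ`, `Tᵃ − Gᵃ ≤ cᵃTᵃ`, `Tᵇ − Gᵇ ≤ cᵇTᵇ`, `0 ≤ cᵇ`, `0 ≤ Tᵇ` ⇒ `TᵃTᵇ − GᵃGᵇ ≤ (cᵃ + cᵇ)·TᵃTᵇ`),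
  ★★ `chi_mul_wGap2At_le_chi_mul_wTop2At` (resummed LOWER half at the top: `χ^{θlo}(s′)·wGap2(s′) ≤ χ^{θ}(s′)·wTop2^{θ,δ′}(s′)` for `θlo ≤ θ ≤ θhi`, `δlo ≤ δ′ ≤ δhi`, `0 ≤ ζ`),
  ★★ `chi_mul_wTop2At_sub_chi_mul_wGap2At_le_collar2_mul` (resummed UPPER half: `… ≤ (collarA(θlo,θhi)(V′) + collarB(δlo,δhi)(init s′)(U,V′)) · χ^{θ}(s′)·wTop2^{θ,δ′}(s′)`).
* §P3 ON THE GRAPH (rows (H-ζ), `Σ|ζ| ≤ 1`, (e1) at level `k`): `topClassWeight2At_eq_graph`, `topGap2CoreAt_eq_graph`, ★ `topGap2ShellAt_eq_graph`, ★ (R) `topGap2ShellAt_nonneg`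
  (`0 ≤ ζ`), ★★ `topGap2ShellAt_le_graph_collar2` (the two-collar shell is dominated on the graph by `(collarA(Ū) + collarB(init s′)(U, Ū))` times the term's integrand).
Sequel (count along both grids, separate selection of the two depths, two runs): `…N21GappedTopPair13CoPHCount`.

HONEST FRAMING (binding).  [folklore] bookkeeping over NODE 00's objects of record; NO estimate of Bałaban's asserted or used; rows displayed; the residual `ζ`, the ℝ-side,
the selector and everything below the top step NOT re-lettered (LOCATED); the common-refinement comparison and the core sandwich are the consumer's; NE7c NOT PRINTED ∕
NOT proved at print's fixed thresholds; N21 NOT discharged; K3⁷ NOT claimed; counts UNMOVED (typed 28∕28 · discharged 5∕27, A 5∕28); never a count claim.  No `sorry`,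
no `axiom`, no `def`, no `instance`, no `notation`.  One finite four-torus programme at fixed `ε` — NOT ℝ⁴, NOT OS, NOT a mass gap, NOT the Clay problem.
-/

noncomputable section

open scoped BigOperators
open Finset MeasureTheory

namespace Summit.QuantumFields.YangMills.Theorems.N21GappedTopPair13CoPH

open Literature.MathematicalPhysics.QuantumFieldTheory.Balaban1983to89
open Literature.MathematicalPhysics.QuantumFieldTheory.Balaban1983to89.T4Continuum
open Literature.MathematicalPhysics.QuantumFieldTheory.Balaban1983to89.Node00
open Summit.QuantumFields.YangMills.BalabanUVNodes.N19MGFRoadLiveSelectorTower (dressedSlotsOfDatum₉_nonneg)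
open Summit.QuantumFields.YangMills.BalabanUVNodes.N19MGFFormAtRecord (wOfRecord₉_nonneg)
open Summit.QuantumFields.YangMills.Theorems.N21ShellSplitOfRecord13CoPH

/-! ## §P1 Faces of the pair-lettered step weights, BY NAME from def-T's lettered provisos -/

section PairFaces

variable (F : T4Family) (N : ℕ) [NeZero N] (ϑ : Stage9Params F N) (p : B12.RunParams) (g : ℕ → ℝ) (k : ℕ)

/-- `|wTop2| ≤ 1` at `Σ|ζ| ≤ 1` (def-T `abs_wOfRecordAt_le_one`). [bookkeeping] -/
theorem abs_wTop2At_le_one (hζ1 : IsZetaAbsLeOne F N ϑ.ν ϑ.τ9.M ϑ.ζ) (θ δ' : ℝ) (s' : SeqOfRecord F ϑ.ν ϑ.τ9.M g p.K (k + 1))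
    (U : GaugeField (F.P p.K) k (SU N)) (V' : GaugeField (F.P p.K) (k + 1) (SU N)) : |wTop2At F N ϑ θ δ' p g k s' U V'| ≤ 1 :=
  abs_wOfRecordAt_le_one F N ϑ.ν ϑ.τ9.M _ _ hζ1 p g k s' U V'

/-- the pair-lettered step weights are jointly measurable under (H-ζ) ((H-U) absolute; def-T `measurable_wOfRecordAt_of_localBg`). [bookkeeping] -/
theorem measurable_wTop2At (hζm : ZetaMeasurable F N ϑ.ζ) (θ δ' : ℝ) (s' : SeqOfRecord F ϑ.ν ϑ.τ9.M g p.K (k + 1)) :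
    Measurable (fun z : GaugeField (F.P p.K) (k + 1) (SU N) × GaugeField (F.P p.K) k (SU N) => wTop2At F N ϑ θ δ' p g k s' z.2 z.1) :=
  measurable_wOfRecordAt_of_localBg (localBgMeasurable F N ϑ.ν) ϑ.τ9.M _ _ hζm p g k s'

/-- the unity law of the pair-lettered step weights against the front factors AT THE SAME (3.2) LETTER (def-T `isStepUnity_wOfRecordAt`; `Σ ζ = 1`). [bookkeeping] -/
theorem isStepUnity_wTop2At (hζu : IsZetaUnity F N ϑ.ν ϑ.τ9.M ϑ.ζ) (θ δ' : ℝ) :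
    IsStepUnity (avOfRecord F N p.K k).avg (chiSeqOfRecordAt F N ϑ.ν ϑ.τ9.M g p.K k (topLetter ϑ.ν θ p g k))
      (chiSeqOfRecordAt F N ϑ.ν ϑ.τ9.M g p.K (k + 1) (topLetter ϑ.ν θ p g (k + 1))) (wTop2At F N ϑ θ δ' p g k) :=
  isStepUnity_wOfRecordAt F N ϑ.ν ϑ.τ9.M _ _ hζu p g k

end PairFaces

/-! ## §P2 «No factor in either collar»: the (3.3) cover and the two-family cover, label by label and through the resummation -/

section Cover2

/-- ★ **THE TWO-FAMILY PRODUCT COVER, generic**: `TᵃTᵇ − GᵃGᵇ = (Tᵃ − Gᵃ)Tᵇ + Gᵃ(Tᵇ − Gᵇ) ≤ cᵃTᵃTᵇ + TᵃcᵇTᵇ = (cᵃ + cᵇ)·TᵃTᵇ` for `0 ≤ Gᵃ ≤ Tᵃ`, `Tᵃ − Gᵃ ≤ cᵃTᵃ`,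
`0 ≤ Tᵇ − Gᵇ ≤ cᵇTᵇ`, `0 ≤ Tᵇ` (lane owner's interface note (i)). [folklore] -/
theorem mul_sub_mul_gap_le {Ta Tb Ga Gb ca cb : ℝ} (hGa0 : 0 ≤ Ga) (hGaT : Ga ≤ Ta) (hTb0 : 0 ≤ Tb) (ha : Ta - Ga ≤ ca * Ta) (hb0 : 0 ≤ Tb - Gb)
    (hb : Tb - Gb ≤ cb * Tb) : Ta * Tb - Ga * Gb ≤ (ca + cb) * (Ta * Tb) := by
  have h1 : (Ta - Ga) * Tb ≤ ca * Ta * Tb := by nlinarith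
  have h2 : Ga * (Tb - Gb) ≤ Ta * (cb * Tb) := mul_le_mul hGaT hb hb0 (hGa0.trans hGaT)
  nlinarith

variable (F : T4Family) (N : ℕ) [NeZero N] (ϑ : Stage9Params F N) (p : B12.RunParams) (g : ℕ → ℝ) (k : ℕ)

/-- ★ **THE (3.3)-LEVEL COVER**: `b|_{δ′}(P,Q) − bGap(δlo, δhi)(P,Q) ≤ collarB(δlo, δhi)(U,V′) · b|_{δ′}(P,Q)` for `δlo ≤ δ′ ≤ δhi` — the lane owner's §29 at the (3.3) factors
(`{0,1}`-valued: `bFactorAt_mul_self`; letter-monotone: `bFactorAt_mono`; index sets `qcubes s P ∖ Q` and `Q`). [bookkeeping] -/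
theorem bWeightAt_sub_bGapAt_le_collarB_mul {δlo δ' δhi : ℝ} (hlo : δlo ≤ δ') (hhi : δ' ≤ δhi) (s : SeqOfRecord F ϑ.ν ϑ.τ9.M g p.K k)
    (Pl Ql : Finset (Iχ F ϑ.ν p g k)) (U : GaugeField (F.P p.K) k (SU N)) (V' : GaugeField (F.P p.K) (k + 1) (SU N)) :
    bWeightAt F N ϑ.ν ϑ.τ9.M p g k δ' s Pl Ql U V' - bGapAt F N ϑ.ν ϑ.τ9.M p g k δlo δhi s Pl Ql U V' ≤
      collarBAt F N ϑ.ν ϑ.τ9.M p g k δlo δhi s U V' * bWeightAt F N ϑ.ν ϑ.τ9.M p g k δ' s Pl Ql U V' := by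
  by_cases hQ : Ql ⊆ qcubes F ϑ.ν ϑ.τ9.M p g k s Pl
  · rw [bWeightAt_eq_prod F N ϑ.ν ϑ.τ9.M p g k δ' s hQ, bGapAt_of_subset F N ϑ.ν ϑ.τ9.M p g k δlo δhi s hQ]
    exact prod_sub_prod_gap_le_collar_mul (lo := fun c => bFactorAt F N ϑ.ν ϑ.τ9.M p g k δlo s c U V')
      (mid := fun c => bFactorAt F N ϑ.ν ϑ.τ9.M p g k δ' s c U V') (hi := fun c => bFactorAt F N ϑ.ν ϑ.τ9.M p g k δhi s c U V') Finset.sdiff_disjoint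
      (fun c => bFactorAt_nonneg F N ϑ.ν ϑ.τ9.M p g k δlo s c U V') (fun c => bFactorAt_mono F N ϑ.ν ϑ.τ9.M p g k hlo s c U V')
      (fun c => bFactorAt_mono F N ϑ.ν ϑ.τ9.M p g k hhi s c U V') (fun c => bFactorAt_le_one F N ϑ.ν ϑ.τ9.M p g k δhi s c U V')
      (fun c => bFactorAt_mul_self F N ϑ.ν ϑ.τ9.M p g k δlo s c U V') (fun c => bFactorAt_mul_self F N ϑ.ν ϑ.τ9.M p g k δ' s c U V')
  · rw [bGapAt_of_not_subset F N ϑ.ν ϑ.τ9.M p g k δlo δhi s hQ, bWeightAt, if_neg hQ, sub_zero, mul_zero]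

/-- ★ **THE TWO-FAMILY LABEL COVER**: `a|_θ(P)·b|_{δ′}(P,Q) − aGap(θlo,θhi)(P)·bGap(δlo,δhi)(P,Q) ≤ (collarA(θlo,θhi)(V′) + collarB(δlo,δhi)(U,V′)) · (a|_θ(P)·b|_{δ′}(P,Q))`
for `θlo ≤ θ ≤ θhi`, `δlo ≤ δ′ ≤ δhi` (U1 `aGapAt_le_aWeightAt`, U2 `aWeightAt_sub_aGapAt_le_collar_mul`, §P2's (3.3) cover, `mul_sub_mul_gap_le`). [bookkeeping] -/
theorem ab_sub_abGap_le_collar2_mul {θlo θ θhi δlo δ' δhi : ℝ} (hθlo : θlo ≤ θ) (hθhi : θ ≤ θhi) (hδlo : δlo ≤ δ') (hδhi : δ' ≤ δhi)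
    (s : SeqOfRecord F ϑ.ν ϑ.τ9.M g p.K k) (Pl Ql : Finset (Iχ F ϑ.ν p g k)) (U : GaugeField (F.P p.K) k (SU N)) (V' : GaugeField (F.P p.K) (k + 1) (SU N)) :
    aWeightAt F N ϑ.ν ϑ.τ9.M p g k θ s Pl V' * bWeightAt F N ϑ.ν ϑ.τ9.M p g k δ' s Pl Ql U V' -
        aGapAt F N ϑ.ν ϑ.τ9.M p g k θlo θhi s Pl V' * bGapAt F N ϑ.ν ϑ.τ9.M p g k δlo δhi s Pl Ql U V' ≤
      (collarAt F N ϑ.ν p g k θlo θhi V' + collarBAt F N ϑ.ν ϑ.τ9.M p g k δlo δhi s U V') *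
        (aWeightAt F N ϑ.ν ϑ.τ9.M p g k θ s Pl V' * bWeightAt F N ϑ.ν ϑ.τ9.M p g k δ' s Pl Ql U V') :=
  mul_sub_mul_gap_le (aGapAt_nonneg F N ϑ.ν ϑ.τ9.M p g k _ _ _ _ _) (aGapAt_le_aWeightAt F N ϑ.ν ϑ.τ9.M p g k hθlo hθhi _ _ _)
    (bWeightAt_nonneg F N ϑ.ν ϑ.τ9.M p g k _ _ _ _ _ _) (aWeightAt_sub_aGapAt_le_collar_mul F N ϑ p g k hθlo hθhi _ _ _)
    (sub_nonneg.2 (bGapAt_le_bWeightAt F N ϑ.ν ϑ.τ9.M p g k hδlo hδhi _ _ _ _ _)) (bWeightAt_sub_bGapAt_le_collarB_mul F N ϑ p g k hδlo hδhi _ _ _ _ _)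

/-- ★★ **THE RESUMMED COVER, LOWER HALF**: at the top (`k + 1 = p.K`), for `θlo ≤ θ ≤ θhi`, `δlo ≤ δ′ ≤ δhi` and `0 ≤ ζ`,
`χ_{k+1}^{θlo}(s′)·wGap2(s′)(U,V′) ≤ χ_{k+1}^{θ}(s′)·wTop2^{θ,δ′}(s′)(U,V′)` — label by label after the front-factor absorptions (`front_absorb_gap`, `front_absorb_at`):
`aGap ≤ a|_θ` times `bGap ≤ b|_{δ′}` times `ζ ≥ 0`. [bookkeeping] -/
theorem chi_mul_wGap2At_le_chi_mul_wTop2At (hk : k + 1 = p.K) (hζ0 : ∀ p g k s Pl Ql RS U V', 0 ≤ ϑ.ζ p g k s Pl Ql RS U V') {θlo θ θhi δlo δ' δhi : ℝ}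
    (hθlo : θlo ≤ θ) (hθhi : θ ≤ θhi) (hδlo : δlo ≤ δ') (hδhi : δ' ≤ δhi) (s' : SeqOfRecord F ϑ.ν ϑ.τ9.M g p.K (k + 1)) (U : GaugeField (F.P p.K) k (SU N))
    (V' : GaugeField (F.P p.K) (k + 1) (SU N)) :
    chiSeqOfRecordAt F N ϑ.ν ϑ.τ9.M g p.K (k + 1) θlo s' V' * wGap2At F N ϑ θlo θhi δlo δhi p g k s' U V' ≤
      chiSeqOfRecordAt F N ϑ.ν ϑ.τ9.M g p.K (k + 1) θ s' V' * wTop2At F N ϑ θ δ' p g k s' U V' := by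
  classical
  rw [wTop2At_apply_top F N ϑ p g k hk, wGap2At_apply]
  unfold resumWeights
  rw [Finset.mul_sum, Finset.mul_sum]
  refine Finset.sum_le_sum fun t ht => ?_
  have hts : σOfRecord F ϑ.ν ϑ.τ9.M p g k s'.init t = s' := (Finset.mem_filter.1 ht).2
  rw [show chiSeqOfRecordAt F N ϑ.ν ϑ.τ9.M g p.K (k + 1) θlo s' V' = chiSeqOfRecordAt F N ϑ.ν ϑ.τ9.M g p.K (k + 1) θlo (σOfRecord F ϑ.ν ϑ.τ9.M p g k s'.init t) V' by
      rw [hts],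
    show chiSeqOfRecordAt F N ϑ.ν ϑ.τ9.M g p.K (k + 1) θ s' V' = chiSeqOfRecordAt F N ϑ.ν ϑ.τ9.M g p.K (k + 1) θ (σOfRecord F ϑ.ν ϑ.τ9.M p g k s'.init t) V' by
      rw [hts]]
  unfold ωGap2At ωOfRecordAt
  rw [← mul_assoc, ← mul_assoc, front_absorb_gap, ← mul_assoc, ← mul_assoc, front_absorb_at]
  exact mul_le_mul_of_nonneg_right (mul_le_mul (aGapAt_le_aWeightAt F N ϑ.ν ϑ.τ9.M p g k hθlo hθhi _ _ _)
    (bGapAt_le_bWeightAt F N ϑ.ν ϑ.τ9.M p g k hδlo hδhi _ _ _ _ _) (bGapAt_nonneg F N ϑ.ν ϑ.τ9.M p g k _ _ _ _ _ _ _)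
    (aWeightAt_nonneg F N ϑ.ν ϑ.τ9.M p g k _ _ _ _)) (hζ0 _ _ _ _ _ _ _ _ _)

/-- ★★ **THE RESUMMED COVER, UPPER HALF**: at the top, for `θlo ≤ θ ≤ θhi`, `δlo ≤ δ′ ≤ δhi` and `0 ≤ ζ`,
`χ^{θ}(s′)·wTop2^{θ,δ′}(s′) − χ^{θlo}(s′)·wGap2(s′) ≤ (collarA(θlo,θhi)(V′) + collarB(δlo,δhi)(init s′)(U,V′)) · χ^{θ}(s′)·wTop2^{θ,δ′}(s′)` pointwise in `(U, V′)` — label by label the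
two-family cover times `ζ ≥ 0` (the (3.3) collar reads the OLD history `init s′`). [bookkeeping] -/
theorem chi_mul_wTop2At_sub_chi_mul_wGap2At_le_collar2_mul (hk : k + 1 = p.K) (hζ0 : ∀ p g k s Pl Ql RS U V', 0 ≤ ϑ.ζ p g k s Pl Ql RS U V')
    {θlo θ θhi δlo δ' δhi : ℝ} (hθlo : θlo ≤ θ) (hθhi : θ ≤ θhi) (hδlo : δlo ≤ δ') (hδhi : δ' ≤ δhi) (s' : SeqOfRecord F ϑ.ν ϑ.τ9.M g p.K (k + 1))
    (U : GaugeField (F.P p.K) k (SU N)) (V' : GaugeField (F.P p.K) (k + 1) (SU N)) :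
    chiSeqOfRecordAt F N ϑ.ν ϑ.τ9.M g p.K (k + 1) θ s' V' * wTop2At F N ϑ θ δ' p g k s' U V' -
        chiSeqOfRecordAt F N ϑ.ν ϑ.τ9.M g p.K (k + 1) θlo s' V' * wGap2At F N ϑ θlo θhi δlo δhi p g k s' U V' ≤
      (collarAt F N ϑ.ν p g k θlo θhi V' + collarBAt F N ϑ.ν ϑ.τ9.M p g k δlo δhi s'.init U V') *
        (chiSeqOfRecordAt F N ϑ.ν ϑ.τ9.M g p.K (k + 1) θ s' V' * wTop2At F N ϑ θ δ' p g k s' U V') := by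
  classical
  rw [wTop2At_apply_top F N ϑ p g k hk, wGap2At_apply]
  unfold resumWeights
  rw [Finset.mul_sum, Finset.mul_sum, ← Finset.sum_sub_distrib, Finset.mul_sum]
  refine Finset.sum_le_sum fun t ht => ?_
  have hts : σOfRecord F ϑ.ν ϑ.τ9.M p g k s'.init t = s' := (Finset.mem_filter.1 ht).2
  rw [show chiSeqOfRecordAt F N ϑ.ν ϑ.τ9.M g p.K (k + 1) θlo s' V' = chiSeqOfRecordAt F N ϑ.ν ϑ.τ9.M g p.K (k + 1) θlo (σOfRecord F ϑ.ν ϑ.τ9.M p g k s'.init t) V' by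
      rw [hts],
    show chiSeqOfRecordAt F N ϑ.ν ϑ.τ9.M g p.K (k + 1) θ s' V' = chiSeqOfRecordAt F N ϑ.ν ϑ.τ9.M g p.K (k + 1) θ (σOfRecord F ϑ.ν ϑ.τ9.M p g k s'.init t) V' by
      rw [hts]]
  unfold ωGap2At ωOfRecordAt
  rw [← mul_assoc, ← mul_assoc, front_absorb_at, ← mul_assoc, ← mul_assoc, front_absorb_gap, ← sub_mul, ← mul_assoc]
  exact mul_le_mul_of_nonneg_right (ab_sub_abGap_le_collar2_mul F N ϑ p g k hθlo hθhi hδlo hδhi _ _ _ _ _) (hζ0 _ _ _ _ _ _ _ _ _)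

end Cover2

/-! ## §P3 The pair-lettered term, the doubly-gapped core and the two-collar shell ON THE GRAPH of the averaging of record -/

section Graph2

variable (F : T4Family) (N : ℕ) [NeZero N] (ϑ : Stage9Params F N) (D : FiniteEpsData F (SU N)) (g₀ : ℕ → ℝ) (os : List (ULoop F))
  (p : B12.RunParams) (g : ℕ → ℝ) (k : ℕ)

/-- **THE PAIR-LETTERED TERM ON THE GRAPH**: `topClassWeight2^{θ,δ′}(s′) = ∫ h(s′)(U) · χ_{k+1}^{θ}(s′)(Ū)·wTop2^{θ,δ′}(s′)(U, Ū) dU` (rows: (H-ζ), `Σ|ζ| ≤ 1`, (e1) at level `k`).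
[bookkeeping] -/
theorem topClassWeight2At_eq_graph (hk : k < p.K) (hζm : ZetaMeasurable F N ϑ.ζ) (hζ1 : IsZetaAbsLeOne F N ϑ.ν ϑ.τ9.M ϑ.ζ) (θ δ' t : ℝ)
    (hint : ∀ s : SeqOfRecord F ϑ.ν ϑ.τ9.M g p.K k,
      Integrable (fun U => chiSeqOfRecord F N ϑ.ν ϑ.τ9.M g p.K k s U * dressedSlotsOfDatum₉ F N ϑ D g₀ os t p g k s U) (fieldMeasure (F.P p.K) k (SU N)))
    (s' : SeqOfRecord F ϑ.ν ϑ.τ9.M g p.K (k + 1)) :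
    topClassWeight2At F N ϑ D g₀ os p g k θ δ' t s' =
      ∫ U, (chiSeqOfRecord F N ϑ.ν ϑ.τ9.M g p.K k s'.init U * dressedSlotsOfDatum₉ F N ϑ D g₀ os t p g k s'.init U) *
        (chiSeqOfRecordAt F N ϑ.ν ϑ.τ9.M g p.K (k + 1) θ s' ((avOfRecord F N p.K k).avg U) * wTop2At F N ϑ θ δ' p g k s' U ((avOfRecord F N p.K k).avg U))
          ∂fieldMeasure (F.P p.K) k (SU N) := by
  have h := integral_mul_tstepOfRecordAt_eq_graph F N ϑ p g k (topLetter ϑ.ν θ) (wTop2At F N ϑ θ δ') hk (dressedSlotsOfDatum₉ F N ϑ D g₀ os t p g k) s'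
    (integrable_oldPiece_topLetter F N ϑ D g₀ os p g k hk θ t hint s') (measurable_wTop2At F N ϑ p g k hζm θ δ' s') (abs_wTop2At_le_one F N ϑ p g k hζ1 θ δ' s')
    (measurable_chiSeqOfRecordAt_of_localBg (localBgMeasurable F N ϑ.ν) ϑ.τ9.M g p.K (k + 1) θ s')
    (fun V => abs_chiSeqOfRecordAt_le_one F N ϑ.ν ϑ.τ9.M g p.K (k + 1) θ s' V)
  rw [chiSeqOfRecordAt_topLetter_of_lt F N ϑ p g k hk θ] at h
  exact h

/-- **THE DOUBLY-GAPPED CORE ON THE GRAPH**: `topGap2Core(s′) = ∫ h(s′)(U) · χ_{k+1}^{θlo}(s′)(Ū)·wGap2(s′)(U, Ū) dU` (rows: (H-ζ), `Σ|ζ| ≤ 1`, `θlo ≤ θhi`, `δlo ≤ δhi`, (e1) at level `k`).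
[bookkeeping] -/
theorem topGap2CoreAt_eq_graph (hk : k < p.K) (hζm : ZetaMeasurable F N ϑ.ζ) (hζ1 : IsZetaAbsLeOne F N ϑ.ν ϑ.τ9.M ϑ.ζ) {θlo θhi δlo δhi : ℝ} (hθ : θlo ≤ θhi)
    (hδ : δlo ≤ δhi) (t : ℝ)
    (hint : ∀ s : SeqOfRecord F ϑ.ν ϑ.τ9.M g p.K k,
      Integrable (fun U => chiSeqOfRecord F N ϑ.ν ϑ.τ9.M g p.K k s U * dressedSlotsOfDatum₉ F N ϑ D g₀ os t p g k s U) (fieldMeasure (F.P p.K) k (SU N)))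
    (s' : SeqOfRecord F ϑ.ν ϑ.τ9.M g p.K (k + 1)) :
    topGap2CoreAt F N ϑ D g₀ os p g k θlo θhi δlo δhi t s' =
      ∫ U, (chiSeqOfRecord F N ϑ.ν ϑ.τ9.M g p.K k s'.init U * dressedSlotsOfDatum₉ F N ϑ D g₀ os t p g k s'.init U) *
        (chiSeqOfRecordAt F N ϑ.ν ϑ.τ9.M g p.K (k + 1) θlo s' ((avOfRecord F N p.K k).avg U) *
          wGap2At F N ϑ θlo θhi δlo δhi p g k s' U ((avOfRecord F N p.K k).avg U)) ∂fieldMeasure (F.P p.K) k (SU N) := by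
  have h := integral_mul_tstepOfRecordAt_eq_graph F N ϑ p g k (topLetter ϑ.ν θlo) (wGap2At F N ϑ θlo θhi δlo δhi) hk (dressedSlotsOfDatum₉ F N ϑ D g₀ os t p g k) s'
    (integrable_oldPiece_topLetter F N ϑ D g₀ os p g k hk θlo t hint s') (measurable_wGap2At F N ϑ p g k hζm θlo θhi δlo δhi s')
    (abs_wGap2At_le_one F N ϑ p g k hζ1 hθ hδ s') (measurable_chiSeqOfRecordAt_of_localBg (localBgMeasurable F N ϑ.ν) ϑ.τ9.M g p.K (k + 1) θlo s')
    (fun V => abs_chiSeqOfRecordAt_le_one F N ϑ.ν ϑ.τ9.M g p.K (k + 1) θlo s' V)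
  rw [chiSeqOfRecordAt_topLetter_of_lt F N ϑ p g k hk θlo] at h
  exact h

/-- ★ **THE TWO-COLLAR SHELL ON THE GRAPH**: at the top, `shell2(s′) = ∫ h(s′)(U)·[χ^{θ}(s′)wTop2^{θ,δ′}(s′) − χ^{θlo}(s′)wGap2(s′)](U, Ū) dU`. [bookkeeping] -/
theorem topGap2ShellAt_eq_graph (hk : k + 1 = p.K) (hζm : ZetaMeasurable F N ϑ.ζ) (hζ1 : IsZetaAbsLeOne F N ϑ.ν ϑ.τ9.M ϑ.ζ) {θlo θ θhi δlo δ' δhi : ℝ}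
    (hθlo : θlo ≤ θ) (hθhi : θ ≤ θhi) (hδlo : δlo ≤ δ') (hδhi : δ' ≤ δhi) (t : ℝ)
    (hint : ∀ s : SeqOfRecord F ϑ.ν ϑ.τ9.M g p.K k,
      Integrable (fun U => chiSeqOfRecord F N ϑ.ν ϑ.τ9.M g p.K k s U * dressedSlotsOfDatum₉ F N ϑ D g₀ os t p g k s U) (fieldMeasure (F.P p.K) k (SU N)))
    (s' : SeqOfRecord F ϑ.ν ϑ.τ9.M g p.K (k + 1)) :
    topGap2ShellAt F N ϑ D g₀ os p g k θlo θ θhi δlo δ' δhi t s' =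
      ∫ U, (chiSeqOfRecord F N ϑ.ν ϑ.τ9.M g p.K k s'.init U * dressedSlotsOfDatum₉ F N ϑ D g₀ os t p g k s'.init U) *
        (chiSeqOfRecordAt F N ϑ.ν ϑ.τ9.M g p.K (k + 1) θ s' ((avOfRecord F N p.K k).avg U) * wTop2At F N ϑ θ δ' p g k s' U ((avOfRecord F N p.K k).avg U) -
          chiSeqOfRecordAt F N ϑ.ν ϑ.τ9.M g p.K (k + 1) θlo s' ((avOfRecord F N p.K k).avg U) *
            wGap2At F N ϑ θlo θhi δlo δhi p g k s' U ((avOfRecord F N p.K k).avg U)) ∂fieldMeasure (F.P p.K) k (SU N) := by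
  have hk' : k < p.K := by omega
  have hU : LocalBgMeasurable F N ϑ.ν := localBgMeasurable F N ϑ.ν
  have hIT := integrable_oldPiece_mul_graph F N ϑ D g₀ os p g k t hint s'
    (b := fun z => chiSeqOfRecordAt F N ϑ.ν ϑ.τ9.M g p.K (k + 1) θ s' z.1 * wTop2At F N ϑ θ δ' p g k s' z.2 z.1)
    (((measurable_chiSeqOfRecordAt_of_localBg hU ϑ.τ9.M g p.K (k + 1) θ s').comp measurable_fst).mul (measurable_wTop2At F N ϑ p g k hζm θ δ' s'))
    (C := 1) (fun z => by
      rw [Real.norm_eq_abs, abs_mul]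
      exact (mul_le_of_le_one_right (abs_nonneg _) (abs_wTop2At_le_one F N ϑ p g k hζ1 θ δ' s' z.2 z.1)).trans
        (abs_chiSeqOfRecordAt_le_one F N ϑ.ν ϑ.τ9.M g p.K (k + 1) θ s' z.1))
  have hIG := integrable_oldPiece_mul_graph F N ϑ D g₀ os p g k t hint s'
    (b := fun z => chiSeqOfRecordAt F N ϑ.ν ϑ.τ9.M g p.K (k + 1) θlo s' z.1 * wGap2At F N ϑ θlo θhi δlo δhi p g k s' z.2 z.1)
    (((measurable_chiSeqOfRecordAt_of_localBg hU ϑ.τ9.M g p.K (k + 1) θlo s').comp measurable_fst).mul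
      (measurable_wGap2At F N ϑ p g k hζm θlo θhi δlo δhi s'))
    (C := 1) (fun z => by
      rw [Real.norm_eq_abs, abs_mul]
      exact (mul_le_of_le_one_right (abs_nonneg _) (abs_wGap2At_le_one F N ϑ p g k hζ1 (hθlo.trans hθhi) (hδlo.trans hδhi) s' z.2 z.1)).trans
        (abs_chiSeqOfRecordAt_le_one F N ϑ.ν ϑ.τ9.M g p.K (k + 1) θlo s' z.1))
  rw [topGap2ShellAt, topClassWeight2At_eq_graph F N ϑ D g₀ os p g k hk' hζm hζ1 θ δ' t hint s',
    topGap2CoreAt_eq_graph F N ϑ D g₀ os p g k hk' hζm hζ1 (hθlo.trans hθhi) (hδlo.trans hδhi) t hint s', ← integral_sub hIT hIG]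
  exact integral_congr_ae (ae_of_all _ fun U => by ring)

/-- ★ (R) **`0 ≤` THE TWO-COLLAR SHELL** (with the definition lane's `topGap2ShellAt_le_topClassWeight2At`: `0 ≤ shell2 ≤ term`): the graph integrand is `h ≥ 0` times the resummed
cover's lower half.  Rows: the top `k + 1 = p.K`, `0 ≤ ζ`, `Σ|ζ| ≤ 1`, (H-ζ), `θlo ≤ θ ≤ θhi`, `δlo ≤ δ′ ≤ δhi`, (e1) at level `k`. [bookkeeping] -/
theorem topGap2ShellAt_nonneg (hk : k + 1 = p.K) (hζ0 : ∀ p g k s Pl Ql RS U V', 0 ≤ ϑ.ζ p g k s Pl Ql RS U V') (hζm : ZetaMeasurable F N ϑ.ζ)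
    (hζ1 : IsZetaAbsLeOne F N ϑ.ν ϑ.τ9.M ϑ.ζ) {θlo θ θhi δlo δ' δhi : ℝ} (hθlo : θlo ≤ θ) (hθhi : θ ≤ θhi) (hδlo : δlo ≤ δ') (hδhi : δ' ≤ δhi) (t : ℝ)
    (hint : ∀ s : SeqOfRecord F ϑ.ν ϑ.τ9.M g p.K k,
      Integrable (fun U => chiSeqOfRecord F N ϑ.ν ϑ.τ9.M g p.K k s U * dressedSlotsOfDatum₉ F N ϑ D g₀ os t p g k s U) (fieldMeasure (F.P p.K) k (SU N)))
    (s' : SeqOfRecord F ϑ.ν ϑ.τ9.M g p.K (k + 1)) : 0 ≤ topGap2ShellAt F N ϑ D g₀ os p g k θlo θ θhi δlo δ' δhi t s' := by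
  rw [topGap2ShellAt_eq_graph F N ϑ D g₀ os p g k hk hζm hζ1 hθlo hθhi hδlo hδhi t hint s']
  refine integral_nonneg fun U => mul_nonneg (mul_nonneg (chiSeqOfRecord_nonneg F N ϑ.ν ϑ.τ9.M g p.K k _ U)
    (dressedSlotsOfDatum₉_nonneg F N ϑ D g₀ os p g (wOfRecord₉_nonneg ϑ hζ0 p g) t k _ U)) (sub_nonneg.2 ?_)
  exact chi_mul_wGap2At_le_chi_mul_wTop2At F N ϑ p g k hk hζ0 hθlo hθhi hδlo hδhi s' U _

/-- ★★ **THE TWO-COLLAR SHELL IS DOMINATED ON THE GRAPH BY THE SUM OF THE TWO COLLAR COUNTS TIMES THE TERM's INTEGRAND**: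
`shell2(s′) ≤ ∫ h(s′)(U) · (collarA(θlo,θhi)(Ū) + collarB(δlo,δhi)(init s′)(U, Ū)) · χ^{θ}(s′)(Ū)·wTop2^{θ,δ′}(s′)(U, Ū) dU`. [bookkeeping] -/
theorem topGap2ShellAt_le_graph_collar2 (hk : k + 1 = p.K) (hζ0 : ∀ p g k s Pl Ql RS U V', 0 ≤ ϑ.ζ p g k s Pl Ql RS U V') (hζm : ZetaMeasurable F N ϑ.ζ)
    (hζ1 : IsZetaAbsLeOne F N ϑ.ν ϑ.τ9.M ϑ.ζ) {θlo θ θhi δlo δ' δhi : ℝ} (hθlo : θlo ≤ θ) (hθhi : θ ≤ θhi) (hδlo : δlo ≤ δ') (hδhi : δ' ≤ δhi) (t : ℝ)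
    (hint : ∀ s : SeqOfRecord F ϑ.ν ϑ.τ9.M g p.K k,
      Integrable (fun U => chiSeqOfRecord F N ϑ.ν ϑ.τ9.M g p.K k s U * dressedSlotsOfDatum₉ F N ϑ D g₀ os t p g k s U) (fieldMeasure (F.P p.K) k (SU N)))
    (s' : SeqOfRecord F ϑ.ν ϑ.τ9.M g p.K (k + 1)) :
    topGap2ShellAt F N ϑ D g₀ os p g k θlo θ θhi δlo δ' δhi t s' ≤
      ∫ U, (chiSeqOfRecord F N ϑ.ν ϑ.τ9.M g p.K k s'.init U * dressedSlotsOfDatum₉ F N ϑ D g₀ os t p g k s'.init U) *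
        ((collarAt F N ϑ.ν p g k θlo θhi ((avOfRecord F N p.K k).avg U) + collarBAt F N ϑ.ν ϑ.τ9.M p g k δlo δhi s'.init U ((avOfRecord F N p.K k).avg U)) *
          (chiSeqOfRecordAt F N ϑ.ν ϑ.τ9.M g p.K (k + 1) θ s' ((avOfRecord F N p.K k).avg U) * wTop2At F N ϑ θ δ' p g k s' U ((avOfRecord F N p.K k).avg U)))
          ∂fieldMeasure (F.P p.K) k (SU N) := by
  have hU : LocalBgMeasurable F N ϑ.ν := localBgMeasurable F N ϑ.ν
  have hI := integrable_oldPiece_mul_graph F N ϑ D g₀ os p g k t hint s'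
    (b := fun z => (collarAt F N ϑ.ν p g k θlo θhi z.1 + collarBAt F N ϑ.ν ϑ.τ9.M p g k δlo δhi s'.init z.2 z.1) *
      (chiSeqOfRecordAt F N ϑ.ν ϑ.τ9.M g p.K (k + 1) θ s' z.1 * wTop2At F N ϑ θ δ' p g k s' z.2 z.1))
    ((((measurable_collarAt F N ϑ.ν p g k θlo θhi).comp measurable_fst).add (measurable_collarBAt F N ϑ.ν ϑ.τ9.M p g k δlo δhi s'.init)).mul
      ((((measurable_chiSeqOfRecordAt_of_localBg hU ϑ.τ9.M g p.K (k + 1) θ s').comp measurable_fst).mul (measurable_wTop2At F N ϑ p g k hζm θ δ' s'))))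
    (C := 2 * Fintype.card (Iχ F ϑ.ν p g k)) (fun z => by
      rw [Real.norm_eq_abs, abs_mul, abs_mul]
      have hA := abs_collarAt_le_card F N ϑ.ν p g k θlo θhi z.1
      have hB := abs_collarBAt_le_card F N ϑ.ν ϑ.τ9.M p g k δlo δhi s'.init z.2 z.1
      have hAB : |collarAt F N ϑ.ν p g k θlo θhi z.1 + collarBAt F N ϑ.ν ϑ.τ9.M p g k δlo δhi s'.init z.2 z.1| ≤ 2 * Fintype.card (Iχ F ϑ.ν p g k) :=
        (abs_add_le _ _).trans (by linarith)
      calc |collarAt F N ϑ.ν p g k θlo θhi z.1 + collarBAt F N ϑ.ν ϑ.τ9.M p g k δlo δhi s'.init z.2 z.1| *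
            (|chiSeqOfRecordAt F N ϑ.ν ϑ.τ9.M g p.K (k + 1) θ s' z.1| * |wTop2At F N ϑ θ δ' p g k s' z.2 z.1|)
          ≤ (2 * Fintype.card (Iχ F ϑ.ν p g k) : ℝ) * (1 * 1) :=
            mul_le_mul hAB
              (mul_le_mul (abs_chiSeqOfRecordAt_le_one F N ϑ.ν ϑ.τ9.M g p.K (k + 1) θ s' z.1) (abs_wTop2At_le_one F N ϑ p g k hζ1 θ δ' s' z.2 z.1)
                (abs_nonneg _) zero_le_one)
              (mul_nonneg (abs_nonneg _) (abs_nonneg _)) (by positivity)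
        _ = 2 * Fintype.card (Iχ F ϑ.ν p g k) := by ring)
  rw [topGap2ShellAt_eq_graph F N ϑ D g₀ os p g k hk hζm hζ1 hθlo hθhi hδlo hδhi t hint s']
  refine integral_mono_of_nonneg (ae_of_all _ fun U => ?_) hI (ae_of_all _ fun U => ?_)
  · exact mul_nonneg (mul_nonneg (chiSeqOfRecord_nonneg F N ϑ.ν ϑ.τ9.M g p.K k _ U)
      (dressedSlotsOfDatum₉_nonneg F N ϑ D g₀ os p g (wOfRecord₉_nonneg ϑ hζ0 p g) t k _ U))
      (sub_nonneg.2 (chi_mul_wGap2At_le_chi_mul_wTop2At F N ϑ p g k hk hζ0 hθlo hθhi hδlo hδhi s' U _))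
  · exact mul_le_mul_of_nonneg_left (chi_mul_wTop2At_sub_chi_mul_wGap2At_le_collar2_mul F N ϑ p g k hk hζ0 hθlo hθhi hδlo hδhi s' U _)
      (mul_nonneg (chiSeqOfRecord_nonneg F N ϑ.ν ϑ.τ9.M g p.K k _ U) (dressedSlotsOfDatum₉_nonneg F N ϑ D g₀ os p g (wOfRecord₉_nonneg ϑ hζ0 p g) t k _ U))

end Graph2

end Summit.QuantumFields.YangMills.Theorems.N21GappedTopPair13CoPH

end
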